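import Mathlib
import Summits.BirchSwinnertonDyer.BirchSwinnertonDyer.Theorems.ManinLocalTwoThreeTwoDvdModularDegreeOfAtkinLehnerInvariant
import HarnessLib

/-!
# The element `g = w(Q)·t` (`Q ∥ N` odd, `4 ∣ N/Q`): `g² = 4Q·γ₀`, and `2 ∣ deg φ_D` when `w_Q f_D = −f_D` and `φ_D(w(Q)∞) = O`

Summit `BirchSwinnertonDyer`, sub-problem `BirchSwinnertonDyer`, route `ManinLocalTwoThree`; width seat `bsd-line-manin23-p2`
(gen 9), `--supports` the crux C2 `ManinOddAtFour` (stmt-BirchSwinnertonDyer-22967).  Companion of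
`ManinLocalTwoThreeTwoDvdModularDegreeOfAtkinLehnerInvariant` (the case `w_Q f = +f`): when `w_Q f = −f`, the half-translate `t`
(`f ∣ t = −f` at `4 ∣ N`) repairs the sign, and `g = w(Q)·t` is again an involution of `Y₀(N)` — `(w(Q)t)² = 4Q·γ₀`,
`γ₀ ∈ Γ₀(N)` explicit, valid whenever `Q` is odd with `4 ∣ N/Q` — with countably many fixed orbits (`γ⁻¹g` scalar forces
`Q = 1`).  Hence, for EITHER Atkin–Lehner sign at an odd `Q ∥ N` with `4 ∣ N/Q`, a parametrisation killing the cusp `w(Q)∞`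
has even degree (`two_dvd_modularDegree_of_cusp_atkinLehnerW_eq_zero`).  This is the level-`4p` mechanism behind
E-an-75 ⟸ E-an-74 (`OddDegreeTooth.OddDegreeForcesQuarterSymbol`), now free of the sign hypothesis `λ_p = +1`.

PROVED here (no `sorry`): `atkinLehnerW_mul_halfTranslateGL_sq`, `eichlerIntegral_wt_smul`, `φ_wt_smul`, `wt_mul_mul_inv_mem`,
`Y0_mk_wt_sq`, `subsingleton_setOf_gamma_smul_eq_wt_smul`, `countable_setOf_exists_gamma_smul_eq_wt_smul`,
**`two_dvd_modularDegree_of_wt_invariant`**, **`two_dvd_modularDegree_of_cusp_atkinLehnerW_eq_zero`** (either sign).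
BSD is not proved by this; Manin's conjecture is not proved by this.
-/

set_option autoImplicit false
set_option linter.dupNamespace false

noncomputable section

open scoped MatrixGroups ModularForm
open CongruenceSubgroup Matrix.SpecialLinearGroup UpperHalfPlane
open Literature.NumberTheory.EllipticCurves Literature.NumberTheory.EllipticCurves.ModularForms
open Summit.BirchSwinnertonDyer.Rank1Residual.ManinAdditive
open Summit.BirchSwinnertonDyer.Rank1Residual.ManinAdditive.ConwayCut

namespace Summit.BirchSwinnertonDyer.BirchSwinnertonDyer.Theorems.ManinLocalTwoThree

variable {N Q : ℕ} [NeZero N] [NeZero Q]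

omit [NeZero N] in
/-- **`(w(Q)·t)² = 4Q·γ₀` with `γ₀ ∈ Γ₀(N)`** for `Q ∥ N` with `4 ∣ N/Q` (then `Q` is odd): `w(Q) = (Qx, y; N, Q)`
(`Qx − (N/Q)y = 1`), `t = (2 1; 0 2)`; `γ₀` explicit (`N/Q = 4M′`, `x = 2x′ + 1`). -/
theorem atkinLehnerW_mul_halfTranslateGL_sq (hQN : Q ∣ N) (hc : Nat.Coprime Q (N / Q)) (h4 : 4 ∣ N / Q) :
    ∃ γ : SL(2, ℤ), γ ∈ Gamma0 N ∧
      glCast (atkinLehnerW N Q : GL (Fin 2) ℚ) * glCast (halfTranslateGL : GL (Fin 2) ℚ) *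
          (glCast (atkinLehnerW N Q : GL (Fin 2) ℚ) * glCast (halfTranslateGL : GL (Fin 2) ℚ)) =
        tpD (4 * Q) * tpG (4 * Q) * mapGL ℝ γ := by
  obtain ⟨M', hM'⟩ := h4
  set x : ℤ := atkinLehnerSL N Q 0 0 with hx
  set y : ℤ := atkinLehnerSL N Q 0 1 with hy
  have hbez : (Q : ℤ) * x - ((N / Q : ℕ) : ℤ) * y = 1 := atkinLehnerSL_bezout N Q hc
  rw [hM'] at hbez
  push_cast at hbez
  have hxodd : Odd x := by
    have hQx : Odd ((Q : ℤ) * x) := ⟨2 * (M' : ℤ) * y, by linear_combination hbez⟩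
    exact (Int.odd_mul.mp hQx).2
  obtain ⟨x', hx'⟩ := hxodd
  have hbez' : (Q : ℤ) * (2 * x' + 1) - 4 * (M' : ℤ) * y = 1 := by rw [← hx']; linear_combination hbez
  have hNQ : N = Q * (4 * M') := by rw [← hM']; exact (Nat.mul_div_cancel' hQN).symm
  -- the explicit `γ₀`
  let A : Matrix (Fin 2) (Fin 2) ℤ :=
    !![(Q : ℤ) * (2 * x' + 1) ^ 2 + 2 * Q * M' * (2 * x' + 1) + 4 * M' * y,
        ((Q : ℤ) * (2 * x' + 1) + 2 * y) * (x' + 1 + M');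
      8 * (Q : ℤ) * M' * (x' + M' + 1),
        2 * (Q : ℤ) * M' * (2 * x' + 1) + 4 * M' * y + 4 * Q * M' ^ 2 + 4 * Q * M' + Q]
  have hdet : A.det = 1 := by
    rw [Matrix.det_fin_two_of]
    linear_combination ((Q : ℤ) * (2 * x' + 1) - 4 * (M' : ℤ) * y + 1) * hbez'
  let γ : SL(2, ℤ) := ⟨A, hdet⟩
  have hγ : γ ∈ Gamma0 N := by
    rw [Gamma0_mem]
    show ((8 * (Q : ℤ) * M' * (x' + M' + 1) : ℤ) : ZMod N) = 0
    rw [ZMod.intCast_zmod_eq_zero_iff_dvd, hNQ]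
    exact ⟨2 * (x' + M' + 1), by push_cast; ring⟩
  refine ⟨γ, hγ, ?_⟩
  have hbezR : (Q : ℝ) * (2 * x' + 1) - 4 * (M' : ℝ) * y = 1 := by exact_mod_cast hbez'
  have hxR : ((x : ℤ) : ℝ) = 2 * (x' : ℝ) + 1 := by exact_mod_cast hx'
  have hNR : (N : ℝ) = (Q : ℝ) * (4 * M') := by exact_mod_cast hNQ
  apply Matrix.GeneralLinearGroup.ext
  intro i j
  simp only [Matrix.GeneralLinearGroup.coe_mul, val_glCast_atkinLehnerW N Q hQN hc, val_glCast_halfTranslateGL,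
    val_tpD, val_tpG, val_mapGL', ← hx, ← hy]
  rw [hxR, hNR]
  fin_cases i <;> fin_cases j <;>
    simp only [γ, A, Matrix.mul_apply, Fin.sum_univ_two, Matrix.map_apply,
      Matrix.of_apply, Matrix.cons_val', Matrix.cons_val_zero, Matrix.cons_val_one, Matrix.empty_val',
      Matrix.cons_val_fin_one, Fin.isValue, Fin.zero_eta, Fin.mk_one] <;> push_cast <;> ring

/-- **`E_f(w(Q) t z) = −ε E_f(z) + {∞, x/(N/Q)}_f`** for a newform `f` at `4 ∣ N` with `w_Q f = ε f` (`f ∣ t = −f`). -/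
theorem eichlerIntegral_wt_smul (hQN : Q ∣ N) (hc : Nat.Coprime Q (N / Q)) (h4 : 4 ∣ N) {f : CuspForm (Gamma0 N) 2}
    (hf : IsNewform0 f) {ε : ℂ} (hε : atkinLehnerInvolution N 2 Q f = ε • f) (z : ℍ) :
    eichlerIntegral f ((glCast (atkinLehnerW N Q : GL (Fin 2) ℚ) * glCast (halfTranslateGL : GL (Fin 2) ℚ)) • z) =
      -ε * eichlerIntegral f z + modularSymbol f ((atkinLehnerSL N Q 0 0 : ℚ) / (N / Q : ℕ)) := by
  rw [mul_smul, eichlerIntegral_atkinLehnerW_smul hQN hc hε, eichlerIntegral_halfTranslateGL_smul h4 hf]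
  ring

/-- **`φ_D(w(Q) t z) = φ_D(z)`** when `w_Q f_D = −f_D`, `4 ∣ N`, and the cusp `w(Q)∞` maps to `O`. -/
theorem φ_wt_smul (hQN : Q ∣ N) (hc : Nat.Coprime Q (N / Q)) (h4 : 4 ∣ N) {W : WeierstrassCurve ℚ} [W.IsElliptic]
    (D : ModularParametrizationData W N) (hε : atkinLehnerInvolution N 2 Q D.f = -D.f)
    (h0 : D.uniformize ((D.c : ℂ) * modularSymbol D.f ((atkinLehnerSL N Q 0 0 : ℚ) / (N / Q : ℕ))) = 0) (z : ℍ) :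
    D.φ ((glCast (atkinLehnerW N Q : GL (Fin 2) ℚ) * glCast (halfTranslateGL : GL (Fin 2) ℚ)) • z) = D.φ z := by
  have hε' : atkinLehnerInvolution N 2 Q D.f = (-1 : ℂ) • D.f := by rw [neg_one_smul]; exact hε
  have hE := eichlerIntegral_wt_smul hQN hc h4 D.isNewformOf.1 hε' z
  simp only [ModularParametrizationData.φ]
  rw [hE, neg_neg, one_mul, mul_add, map_add, h0, add_zero]

omit [NeZero N] in
/-- `w(Q)·t` normalises `Γ₀(N)` (`4 ∣ N`). -/
theorem wt_mul_mul_inv_mem (hQN : Q ∣ N) (hc : Nat.Coprime Q (N / Q)) (h4 : 4 ∣ N) {x : GL (Fin 2) ℝ}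
    (hx : x ∈ (Gamma0 N : Subgroup (GL (Fin 2) ℝ))) :
    glCast (atkinLehnerW N Q : GL (Fin 2) ℚ) * glCast (halfTranslateGL : GL (Fin 2) ℚ) * x *
        (glCast (atkinLehnerW N Q : GL (Fin 2) ℚ) * glCast (halfTranslateGL : GL (Fin 2) ℚ))⁻¹ ∈
      (Gamma0 N : Subgroup (GL (Fin 2) ℝ)) := by
  have h := atkinLehnerW_mul_mul_inv_mem N Q hQN hc (halfTranslateGL_mul_mul_inv_mem h4 hx)
  rw [mul_inv_rev, show glCast (atkinLehnerW N Q : GL (Fin 2) ℚ) * glCast (halfTranslateGL : GL (Fin 2) ℚ) * x *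
      ((glCast (halfTranslateGL : GL (Fin 2) ℚ))⁻¹ * (glCast (atkinLehnerW N Q : GL (Fin 2) ℚ))⁻¹) =
    glCast (atkinLehnerW N Q : GL (Fin 2) ℚ) *
      (glCast (halfTranslateGL : GL (Fin 2) ℚ) * x * (glCast (halfTranslateGL : GL (Fin 2) ℚ))⁻¹) *
      (glCast (atkinLehnerW N Q : GL (Fin 2) ℚ))⁻¹ by simp only [mul_assoc]]
  exact h

omit [NeZero N] in
/-- **`[(w(Q)t) (w(Q)t) z] = [z]` in `Y₀(N)`** (`Q ∥ N`, `4 ∣ N/Q`). -/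
theorem Y0_mk_wt_sq (hQN : Q ∣ N) (hc : Nat.Coprime Q (N / Q)) (h4 : 4 ∣ N / Q) (z : ℍ) :
    Y0.mk N ((glCast (atkinLehnerW N Q : GL (Fin 2) ℚ) * glCast (halfTranslateGL : GL (Fin 2) ℚ)) •
      (glCast (atkinLehnerW N Q : GL (Fin 2) ℚ) * glCast (halfTranslateGL : GL (Fin 2) ℚ)) • z) = Y0.mk N z := by
  obtain ⟨γ₀, hγ₀, hsq⟩ := atkinLehnerW_mul_halfTranslateGL_sq hQN hc h4
  rw [smul_smul, hsq, mul_smul, Y0.mk_eq_mk_iff]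
  refine ⟨⟨γ₀, hγ₀⟩, ?_⟩
  change (mapGL ℝ γ₀ : GL (Fin 2) ℝ) • z = (tpD (4 * Q) * tpG (4 * Q)) • (mapGL ℝ γ₀ : GL (Fin 2) ℝ) • z
  have hQ0 : (0 : ℝ) < Q := by exact_mod_cast NeZero.pos Q
  have hQ : (0 : ℝ) < 4 * Q := by linarith
  have hdet : 0 < (tpD (4 * Q) * tpG (4 * Q) : GL (Fin 2) ℝ).det.val := by
    rw [map_mul, Units.val_mul]
    have h1 : 0 < (tpD (4 * Q) : GL (Fin 2) ℝ).det.val := by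
      rw [Matrix.GeneralLinearGroup.val_det_apply, val_tpD, Matrix.det_fin_two_of]; push_cast; nlinarith
    have h2 : 0 < (tpG (4 * Q) : GL (Fin 2) ℝ).det.val := by
      rw [Matrix.GeneralLinearGroup.val_det_apply, val_tpG, Matrix.det_fin_two_of]; push_cast; nlinarith
    exact mul_pos h1 h2
  have hval : ((tpD (4 * Q) * tpG (4 * Q) : GL (Fin 2) ℝ) : Matrix (Fin 2) (Fin 2) ℝ) =
      !![((4 * Q : ℕ) : ℝ), 0; 0, ((4 * Q : ℕ) : ℝ)] := by
    rw [Matrix.GeneralLinearGroup.coe_mul, val_tpD, val_tpG]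
    ext i j
    fin_cases i <;> fin_cases j <;> simp [Matrix.mul_apply, Fin.sum_univ_two]
  have e10 : (tpD (4 * Q) * tpG (4 * Q) : GL (Fin 2) ℝ) 1 0 = 0 := by
    show ((tpD (4 * Q) * tpG (4 * Q) : GL (Fin 2) ℝ) : Matrix (Fin 2) (Fin 2) ℝ) 1 0 = 0; rw [hval]; simp
  have e01 : (tpD (4 * Q) * tpG (4 * Q) : GL (Fin 2) ℝ) 0 1 = 0 := by
    show ((tpD (4 * Q) * tpG (4 * Q) : GL (Fin 2) ℝ) : Matrix (Fin 2) (Fin 2) ℝ) 0 1 = 0; rw [hval]; simp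
  have e00 : (tpD (4 * Q) * tpG (4 * Q) : GL (Fin 2) ℝ) 0 0 = (tpD (4 * Q) * tpG (4 * Q) : GL (Fin 2) ℝ) 1 1 := by
    show ((tpD (4 * Q) * tpG (4 * Q) : GL (Fin 2) ℝ) : Matrix (Fin 2) (Fin 2) ℝ) 0 0 =
      ((tpD (4 * Q) * tpG (4 * Q) : GL (Fin 2) ℝ) : Matrix (Fin 2) (Fin 2) ℝ) 1 1
    rw [hval]; simp
  rw [smul_eq_self_of_scalar hdet e10 e01 e00]

/-- **`γ z = (w(Q)t) z` has at most one solution** (`Q > 1`): `γ⁻¹ (w(Q)t) = a·1` scalar gives `2N = γ₁₀·a`, `a² = 4Q`,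
`N ∣ γ₁₀`, whence `Q = 1`. -/
theorem subsingleton_setOf_gamma_smul_eq_wt_smul (hQN : Q ∣ N) (hc : Nat.Coprime Q (N / Q)) (hQ1 : Q ≠ 1)
    (γ : Gamma0 N) :
    ({z : ℍ | γ • z = (glCast (atkinLehnerW N Q : GL (Fin 2) ℚ) * glCast (halfTranslateGL : GL (Fin 2) ℚ)) • z}
      : Set ℍ).Subsingleton := by
  set g₀ : GL (Fin 2) ℝ := glCast (atkinLehnerW N Q : GL (Fin 2) ℚ) * glCast (halfTranslateGL : GL (Fin 2) ℚ) with hg₀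
  set G : GL (Fin 2) ℝ := (mapGL ℝ (γ : SL(2, ℤ)) : GL (Fin 2) ℝ) with hG
  set g : GL (Fin 2) ℝ := G⁻¹ * g₀ with hg
  have hdet0 : 0 < g₀.det.val := by
    rw [hg₀, map_mul, Units.val_mul]; exact mul_pos (det_glCast_pos _) (det_glCast_pos _)
  have hdetG : G.det.val = 1 := det_mapGL_val γ
  have hdetg : 0 < g.det.val := by
    rw [hg, map_mul, map_inv, Units.val_mul, Units.val_inv_eq_inv_val, hdetG, inv_one, one_mul]
    exact hdet0
  have hset : ∀ z : ℍ, γ • z = g₀ • z ↔ g • z = z := by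
    intro z
    change G • z = g₀ • z ↔ (G⁻¹ * g₀) • z = z
    rw [mul_smul G⁻¹ g₀ z, inv_smul_eq_iff, eq_comm]
  intro z₁ h₁ z₂ h₂
  by_contra hne
  rw [Set.mem_setOf_eq, hset] at h₁ h₂
  obtain ⟨hc0, hb, had⟩ := scalar_of_two_fixedPoints hdetg h₁ h₂ hne
  have hGg : G * g = g₀ := by rw [hg, mul_inv_cancel_left]
  have hent : ∀ i j, (g₀ : Matrix (Fin 2) (Fin 2) ℝ) i j =
      ∑ k, (G : Matrix (Fin 2) (Fin 2) ℝ) i k * (g : Matrix (Fin 2) (Fin 2) ℝ) k j := by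
    intro i j
    rw [← hGg, Matrix.GeneralLinearGroup.coe_mul, Matrix.mul_apply]
  have h10 := hent 1 0
  rw [Fin.sum_univ_two] at h10
  have hg10 : (g₀ : Matrix (Fin 2) (Fin 2) ℝ) 1 0 = 2 * N := by
    rw [hg₀, Matrix.GeneralLinearGroup.coe_mul, val_glCast_atkinLehnerW N Q hQN hc, val_glCast_halfTranslateGL]
    simp [Matrix.mul_apply, Fin.sum_univ_two]; ring
  have hG10 : (G : Matrix (Fin 2) (Fin 2) ℝ) 1 0 = (((γ : SL(2, ℤ)) 1 0 : ℤ) : ℝ) := by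
    rw [hG, val_mapGL']; simp
  have hG11g : (G : Matrix (Fin 2) (Fin 2) ℝ) 1 1 * (g : Matrix (Fin 2) (Fin 2) ℝ) 1 0 = 0 := by
    rw [show (g : Matrix (Fin 2) (Fin 2) ℝ) 1 0 = g 1 0 from rfl, hc0, mul_zero]
  rw [hg10, hG10, hG11g, add_zero] at h10
  -- `det g₀ = 4Q`
  have hdet4Q : g₀.det.val = 4 * Q := by
    have hbez : (Q : ℝ) * (((atkinLehnerSL N Q) 0 0 : ℤ) : ℝ) - ((N / Q : ℕ) : ℝ) * (((atkinLehnerSL N Q) 0 1 : ℤ) : ℝ) = 1 := by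
      have h := congrArg (fun z : ℤ => (z : ℝ)) (atkinLehnerSL_bezout N Q hc)
      simp only [Int.cast_sub, Int.cast_mul, Int.cast_natCast, Int.cast_one] at h
      linear_combination h
    have hNQ : (N : ℝ) = (Q : ℝ) * ((N / Q : ℕ) : ℝ) := by exact_mod_cast (Nat.mul_div_cancel' hQN).symm
    rw [hg₀, Matrix.GeneralLinearGroup.val_det_apply, Matrix.GeneralLinearGroup.coe_mul, Matrix.det_mul,
      val_glCast_atkinLehnerW N Q hQN hc, val_glCast_halfTranslateGL, Matrix.det_fin_two_of, Matrix.det_fin_two_of, hNQ]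
    push_cast
    linear_combination (4 * (Q : ℝ)) * hbez
  have hdetprod : g₀.det.val = G.det.val * g.det.val := by rw [← hGg, map_mul, Units.val_mul]
  have hdetg' : g.det.val = g 0 0 * g 0 0 := by
    rw [Matrix.GeneralLinearGroup.val_det_apply, Matrix.det_fin_two]
    rw [show (g : Matrix (Fin 2) (Fin 2) ℝ) 1 0 = g 1 0 from rfl, show (g : Matrix (Fin 2) (Fin 2) ℝ) 0 1 = g 0 1 from rfl,
      show (g : Matrix (Fin 2) (Fin 2) ℝ) 1 1 = g 1 1 from rfl, show (g : Matrix (Fin 2) (Fin 2) ℝ) 0 0 = g 0 0 from rfl,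
      hc0, hb, ← had]
    ring
  rw [hdetprod, hdetG, one_mul, hdetg'] at hdet4Q
  set a : ℝ := g 0 0 with ha
  set c : ℤ := (γ : SL(2, ℤ)) 1 0 with hcdef
  -- `2N = c a`, `a² = 4Q` ⟹ `4N² = 4 c² Q`
  have hsq : 4 * ((N : ℝ)) ^ 2 = ((c : ℝ)) ^ 2 * (4 * Q) := by
    have e : 2 * (N : ℝ) = (c : ℝ) * a := by rw [h10]
    rw [← hdet4Q]; nlinarith [e]
  have hsqZ : 4 * ((N : ℤ)) ^ 2 = c ^ 2 * (4 * Q) := by exact_mod_cast hsq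
  have hdvd : ((N : ℕ) : ℤ) ∣ c := (ZMod.intCast_zmod_eq_zero_iff_dvd c N).mp (Gamma0_mem.mp γ.2)
  obtain ⟨k, hk⟩ := hdvd
  have hNpos : (0 : ℤ) < N := by exact_mod_cast NeZero.pos N
  rw [hk] at hsqZ
  have h1 : k ^ 2 * (Q : ℤ) = 1 := by
    have hN2 : ((N : ℤ)) ^ 2 ≠ 0 := pow_ne_zero 2 hNpos.ne'
    have : ((N : ℤ)) ^ 2 * (4 * (k ^ 2 * Q)) = ((N : ℤ)) ^ 2 * 4 := by linear_combination -hsqZ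
    have h4 := mul_left_cancel₀ hN2 this
    linarith
  have hk1 : k ^ 2 = 1 := Int.eq_one_of_mul_eq_one_right (sq_nonneg k) h1
  have hQ1' : (Q : ℤ) = 1 := by rw [hk1, one_mul] at h1; exact h1
  exact hQ1 (by exact_mod_cast hQ1')

/-- The `(w(Q)t)`-fixed `Γ₀(N)`-orbits form a countable set (`Q > 1`). -/
theorem countable_setOf_exists_gamma_smul_eq_wt_smul (hQN : Q ∣ N) (hc : Nat.Coprime Q (N / Q)) (hQ1 : Q ≠ 1) :
    ({z : ℍ | ∃ γ : Gamma0 N,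
        γ • z = (glCast (atkinLehnerW N Q : GL (Fin 2) ℚ) * glCast (halfTranslateGL : GL (Fin 2) ℚ)) • z} : Set ℍ).Countable := by
  haveI : Countable SL(2, ℤ) := countable_SL2Z
  have hunion : ({z : ℍ | ∃ γ : Gamma0 N,
      γ • z = (glCast (atkinLehnerW N Q : GL (Fin 2) ℚ) * glCast (halfTranslateGL : GL (Fin 2) ℚ)) • z} : Set ℍ) =
      ⋃ γ : Gamma0 N,
        {z : ℍ | γ • z = (glCast (atkinLehnerW N Q : GL (Fin 2) ℚ) * glCast (halfTranslateGL : GL (Fin 2) ℚ)) • z} := by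
    ext z; simp only [Set.mem_setOf_eq, Set.mem_iUnion]
  rw [hunion]
  exact Set.countable_iUnion fun γ => (subsingleton_setOf_gamma_smul_eq_wt_smul hQN hc hQ1 γ).countable

/-- **`2 ∣ deg φ_D` when `w_Q f_D = −f_D`** (`Q ∥ N`, `Q > 1`, `4 ∣ N/Q`) and the cusp `w(Q)∞` maps to `O`: fibre counting
with the involution `w(Q)t` of `Y₀(N)`. -/
theorem two_dvd_modularDegree_of_wt_invariant (hQN : Q ∣ N) (hc : Nat.Coprime Q (N / Q)) (hQ1 : Q ≠ 1)
    (h4 : 4 ∣ N / Q) {W : WeierstrassCurve ℚ} [W.IsElliptic] (D : ModularParametrizationData W N)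
    (hε : atkinLehnerInvolution N 2 Q D.f = -D.f)
    (h0 : D.uniformize ((D.c : ℂ) * modularSymbol D.f ((atkinLehnerSL N Q 0 0 : ℚ) / (N / Q : ℕ))) = 0) :
    2 ∣ D.modularDegree := by
  classical
  have h4N : 4 ∣ N := h4.trans (Nat.div_dvd_of_dvd hQN)
  set g₀ : GL (Fin 2) ℝ := glCast (atkinLehnerW N Q : GL (Fin 2) ℚ) * glCast (halfTranslateGL : GL (Fin 2) ℚ) with hg₀
  set F : Set ℍ := {z : ℍ | ∃ γ : Gamma0 N, γ • z = g₀ • z} with hF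
  have hFc : F.Countable := countable_setOf_exists_gamma_smul_eq_wt_smul hQN hc hQ1
  set Bad : Set (W.baseChange ℂ).toAffine.Point := {P | D.fiberOrbitCount P ≠ D.modularDegree} ∪ D.φ '' F with hBad
  have hBadc : Bad.Countable := D.finite_setOf_fiberOrbitCount_ne.countable.union (hFc.image _)
  obtain ⟨P, hP⟩ : ∃ P, P ∉ Bad := by
    by_contra hall
    simp only [not_exists, not_not] at hall
    exact not_countable_univ_points D (hBadc.mono fun P _ => hall P)
  have hcount : D.fiberOrbitCount P = D.modularDegree := by
    by_contra h
    exact hP (Or.inl h)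
  have hPF : ∀ z : ℍ, D.φ z = P → z ∉ F := fun z hz hzF => hP (Or.inr ⟨z, hzF, hz⟩)
  set S := {y : Y0 N // ∃ τ : ℍ, Y0.mk N τ = y ∧ D.φ τ = P} with hS
  have hcardS : Nat.card S = D.modularDegree := hcount
  haveI : Finite S := Nat.finite_of_card_ne_zero (by rw [hcardS]; exact D.deg_pos.ne')
  letI : Fintype S := Fintype.ofFinite S
  have hnorm : ∀ x ∈ (Gamma0 N : Subgroup (GL (Fin 2) ℝ)), g₀ * x * g₀⁻¹ ∈ (Gamma0 N : Subgroup (GL (Fin 2) ℝ)) :=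
    fun x hx => wt_mul_mul_inv_mem hQN hc h4N hx
  have hinv : ∀ z : ℍ, D.φ (g₀ • z) = D.φ z := φ_wt_smul hQN hc h4N D hε h0
  let σ : Function.End S := fun y =>
    ⟨Y0.mk N (g₀ • y.2.choose), g₀ • y.2.choose, rfl, by rw [hinv]; exact y.2.choose_spec.2⟩
  have hσ : ∀ (y : S) (τ : ℍ), Y0.mk N τ = y.1 → (σ y).1 = Y0.mk N (g₀ • τ) := by
    intro y τ hτ
    show Y0.mk N (g₀ • y.2.choose) = Y0.mk N (g₀ • τ)
    exact Y0_mk_smul_eq_of_mk_eq hnorm (y.2.choose_spec.1.trans hτ.symm)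
  have hσ2 : σ ^ 2 ^ 1 = 1 := by
    rw [pow_one]
    funext y
    obtain ⟨τ, hτ, -⟩ := y.2
    have h1 := hσ y τ hτ
    have h2 := hσ (σ y) (g₀ • τ) h1.symm
    apply Subtype.ext
    show (σ (σ y)).1 = y.1
    rw [h2, Y0_mk_wt_sq hQN hc h4 τ, hτ]
  haveI : IsEmpty (Function.fixedPoints σ) := by
    refine ⟨fun ⟨y, hy⟩ => ?_⟩
    obtain ⟨τ, hτ, hφ⟩ := y.2
    have h1 := hσ y τ hτ
    rw [Function.mem_fixedPoints_iff] at hy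
    rw [hy] at h1
    obtain ⟨γ, hγ⟩ := (Y0.mk_eq_mk_iff N _ _).mp (hτ.trans h1).symm
    exact hPF τ hφ ⟨γ, hγ⟩
  haveI : Fact (Nat.Prime 2) := ⟨Nat.prime_two⟩
  have hmod := Equiv.Perm.card_fixedPoints_modEq (p := 2) (n := 1) hσ2
  rw [Fintype.card_eq_zero (α := ↥(Function.fixedPoints σ)), Nat.ModEq, Nat.zero_mod] at hmod
  change 2 ∣ D.modularDegree
  rw [← hcardS, Nat.card_eq_fintype_card]
  exact Nat.dvd_of_mod_eq_zero hmod

/-- **Either sign**: for `Q ∥ N`, `Q > 1`, `4 ∣ N/Q`, and ANY datum `D` whose parametrisation kills the cusp `w(Q)∞`,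
`2 ∣ deg φ_D` (`w_Q f_D = ±f_D` by Atkin–Lehner; `+`: `w(Q)` itself, `−`: `w(Q)t`). -/
theorem two_dvd_modularDegree_of_cusp_atkinLehnerW_eq_zero (hQN : Q ∣ N) (hc : Nat.Coprime Q (N / Q)) (hQ1 : Q ≠ 1)
    (h4 : 4 ∣ N / Q) {W : WeierstrassCurve ℚ} [W.IsElliptic] (D : ModularParametrizationData W N)
    (h0 : D.uniformize ((D.c : ℂ) * modularSymbol D.f ((atkinLehnerSL N Q 0 0 : ℚ) / (N / Q : ℕ))) = 0) :
    2 ∣ D.modularDegree := by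
  obtain ⟨ε, hε, hw⟩ := IsNewform0.exists_atkinLehnerInvolution_eq_smul D.isNewformOf.1 hQN hc
  rcases hε with rfl | rfl
  · exact two_dvd_modularDegree_of_atkinLehnerW_invariant hQN hc hQ1 D (by rw [hw, one_smul]) h0
  · exact two_dvd_modularDegree_of_wt_invariant hQN hc hQ1 h4 D (by rw [hw, neg_one_smul]) h0

end Summit.BirchSwinnertonDyer.BirchSwinnertonDyer.Theorems.ManinLocalTwoThree

end
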